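import Summits.CriticalPhenomena.SAWScalingLimit.Theorems.SAWLoopFugacityFlowIsingBoundaryRatioSideCrossSeparation
import Literature.Probability.LatticeModels.MeshDomainJordan
import Literature.Probability.RandomPlanarGeometry.ImageUnivalent
import Literature.Topology.PlaneTopology.HalfDiscCrosscut
import HarnessLib

/-!
# One ball-component of `Ω_δ` at the marked prime end
(line `fk-anchor-transfer`, crux `IsingBoundaryRatio`, stmt-CriticalPhenomena-10650)

The lattice-topology piece `ChartDiscOneComponent` (file `…IsingBoundaryRatioRSWMeshDefs.lean`) of the
RSW input of the line, PROVED (`stub_chartDiscOneComponent`): for the chordal chart `φ : ℍ → D` of a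
Dobrushin domain `(D; a, b)` and `ε > 0` there is `R₀ > 0` such that for every `R < R₀` and all small
meshes `δ`, any two vertices of the mesh graph `Ω_δ = meshDomain D δ` of chart radius `< R` are joined by
a walk of `Ω_δ` all of whose vertices have mesh point in `B(a, ε)`.

Proof (no probability, no cross-cut theorem). Let `R₀` be such that `φ({|w| < 2R₀} ∩ ℍ) ⊆ B(a, ε)`
(boundary value `a` at `0`), fix `R < R₀`, `ρ = 2R`, and let `D' = φ({|w| < ρ} ∩ ℍ)`, the chart
half-disc: the image of the half-disc Jordan domain (`Literature.Topology.PlaneTopology.halfDisc`) under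
the Carathéodory boundary extension of `φ`, continuous and injective on the closed half-plane, hence
again a Jordan domain (`JordanDomain.image`, `exists_chartHalfDisc`). Two facts of the tree about the
mesh graph of a JORDAN domain are applied to `D'`: big mesh components are the bulk
(`JordanDomain.exists_mem_meshDomain_of_reachable`: for small `δ`, a mesh vertex joined in the mesh
graph of `D'` to a vertex at Euclidean distance `≥ d₀` lies in `meshDomain D'`), and `meshDomain D'` is
a single mesh component (`JordanDomain.exists_forall_mem_meshDomain_and_reachable`). Now let `x` be a
vertex of `Ω_δ` of chart radius `< R`. As `Ω_δ` is one component swallowing every compact of `D`, `x`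
is joined in the mesh graph of `D` to a lattice point next to `φ(ir)`, of chart radius `> ρ`; follow
such a walk up to the last vertex `w` before the chart radius first reaches `ρ - R/8`: by uniform
continuity of the Carathéodory extension `g` of `φ⁻¹` on `closure D` away from `b`
(`exists_chart_extension`), for small `δ` the chart oscillation over `δ` is `< R/8`, so `w` has chart
radius `≥ ρ - R/4`, every vertex of the piece lies in `D'` and every closed edge of it in
`closure D'` (`mem_closure_chartHalfDisc`) — the piece is a walk of the mesh graph of `D'`
(`reachable_restrict`) — and `dist (δx) (δw) ≥ d₀(R)`. Hence `x ∈ meshDomain D'`; the same for `y`;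
so `x` and `y` are joined in the mesh graph of `D'`, by a walk which is a walk of `Ω_δ`
(`exists_walk_discreteDomainGraph`: `Ω_δ` is a union of mesh components) with all vertices in
`D' ⊆ B(a, ε)`.

References (shape of the objects only; all statements here are folklore): Ch. Pommerenke, *Boundary
Behaviour of Conformal Maps* (1992), Thm. 2.6 [`PommerenkeBBCM1992`]; S. Smirnov, C. R. Acad. Sci. 333
(2001), §2 (largest-component discretisation).
-/

noncomputable section

open scoped Classical Topology
open Filter Set Metric SimpleGraph Complex
open Literature.Probability.LatticeModels Literature.Probability.RandomPlanarGeometry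
open Literature.Probability.Percolation (BondConfig)
open Literature.Topology.PlaneTopology
open UpperHalfPlane (upperHalfPlaneSet)

namespace Summit.CriticalPhenomena.SAWScalingLimit.Theorems.IsingBoundaryRatio

/-! ### The chart half-disc as a Jordan domain -/

/-- **The chart half-disc is a Jordan domain.** For a conformal chart `φ : ℍ → D` of a Jordan
domain and `ρ > 0`, the sub-domain `{z ∈ D | ‖φ⁻¹ z‖ < ρ} = φ({|w| < ρ} ∩ ℍ)` is the carrier of a
Jordan domain (the image of the half-disc under the Carathéodory extension of `φ`, continuous and
injective on the closed half-plane). [cite: PommerenkeBBCM1992, Thm. 2.6] -/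
theorem exists_chartHalfDisc (D : JordanDomain) (φ : ConformalEquiv upperHalfPlaneSet D.carrier) {ρ : ℝ}
    (hρ : 0 < ρ) : ∃ D' : JordanDomain, D'.carrier = {z ∈ D.carrier | ‖φ.symm z‖ < ρ} := by
  obtain ⟨Ψ, hΨc, hΨeq, hbij, -⟩ :=
    JordanDomain.exists_continuousOn_extension_holds D (cayley.symm.trans φ)
  have hcl : closure (halfDisc ρ hρ).carrier = closedBall (0 : ℂ) ρ ∩ {z : ℂ | 0 ≤ z.im} := by
    rw [carrier_halfDisc, closure_ball_inter_upperHalfPlaneSet hρ]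
  have hc : ContinuousOn φ.boundaryExtension (closure (halfDisc ρ hρ).carrier) := by
    refine (JordanDomain.continuousOn_boundaryExtension_of_disc
      JordanDomain.exists_continuousOn_extension_holds D φ).mono ?_
    rw [hcl]
    exact fun z hz => mem_closure_upperHalfPlaneSet_iff.2 hz.2
  have hi : InjOn φ.boundaryExtension (closure (halfDisc ρ hρ).carrier) := by
    rw [hcl]
    intro z hz w hw heq
    have hz' : 0 ≤ z.im := hz.2
    have hw' : 0 ≤ w.im := hw.2
    rw [JordanDomain.boundaryExtension_eq_of_extension φ hΨc hΨeq hz',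
      JordanDomain.boundaryExtension_eq_of_extension φ hΨc hΨeq hw'] at heq
    have h1 := hbij.injOn (mem_closedBall_zero_iff.2 (norm_cayleyFun_le_one hz'))
      (mem_closedBall_zero_iff.2 (norm_cayleyFun_le_one hw')) heq
    have h2 := congrArg cayleyInvFun h1
    rwa [cayleyInvFun_cayleyFun (add_I_ne_zero hz'), cayleyInvFun_cayleyFun (add_I_ne_zero hw')] at h2
  refine ⟨(halfDisc ρ hρ).image φ.boundaryExtension hc hi, ?_⟩
  ext z
  simp only [JordanDomain.carrier_image, carrier_halfDisc, mem_image, mem_inter_iff, mem_setOf_eq]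
  constructor
  · rintro ⟨w, ⟨hwρ, hwH⟩, rfl⟩
    rw [φ.boundaryExtension_eq hwH]
    refine ⟨φ.mapsTo hwH, ?_⟩
    rw [φ.symm_apply_apply hwH]
    exact mem_ball_zero_iff.1 hwρ
  · rintro ⟨hzD, hzρ⟩
    refine ⟨φ.symm z, ⟨mem_ball_zero_iff.2 hzρ, φ.symm_mapsTo hzD⟩, ?_⟩
    rw [φ.boundaryExtension_eq (φ.symm_mapsTo hzD), φ.apply_symm_apply hzD]

/-- **Points of the closure in chart radius `< ρ` are in the closure of the chart half-disc**: if `g`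
extends `ψ = φ⁻¹` continuously to `closure D ∖ {b}`, a point `z ≠ b` of `closure D` with `‖g z‖ < ρ` is a
limit of points of `D` of chart radius `< ρ`. [folklore] -/
theorem mem_closure_chartHalfDisc {Dc : Set ℂ} {b : ℂ} (hb : b ∉ Dc) {g ψ : ℂ → ℂ}
    (hgc : ContinuousOn g (closure Dc \ {b})) (hgeq : EqOn g ψ Dc) {ρ : ℝ} {z : ℂ} (hz : z ∈ closure Dc)
    (hzb : z ≠ b) (hgz : ‖g z‖ < ρ) : z ∈ closure {z ∈ Dc | ‖ψ z‖ < ρ} := by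
  rw [Metric.mem_closure_iff]
  intro ε hε
  have hcont : ContinuousWithinAt g (closure Dc \ {b}) z := hgc z ⟨hz, hzb⟩
  have hopen : {w : ℂ | ‖w‖ < ρ} ∈ 𝓝 (g z) :=
    (isOpen_lt continuous_norm continuous_const).mem_nhds hgz
  obtain ⟨ε₁, hε₁, hsub⟩ := Metric.mem_nhdsWithin_iff.1 (hcont hopen)
  obtain ⟨z', hz'D, hzz'⟩ := Metric.mem_closure_iff.1 hz (min ε ε₁) (lt_min hε hε₁)
  refine ⟨z', ⟨hz'D, ?_⟩, hzz'.trans_le (min_le_left _ _)⟩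
  have hz'b : z' ≠ b := fun h => hb (h ▸ hz'D)
  have h1 : z' ∈ g ⁻¹' {w : ℂ | ‖w‖ < ρ} :=
    hsub ⟨Metric.mem_ball'.2 (hzz'.trans_le (min_le_right _ _)),
      subset_closure hz'D, hz'b⟩
  have h2 : ‖g z'‖ < ρ := h1
  rwa [hgeq hz'D] at h2

/-! ### Walk bookkeeping -/

/-- **Prefix of a walk before a predicate first fails**: if `P` holds at the start and fails at the end,
there is a prefix all of whose vertices satisfy `P`, ending at a vertex adjacent to one where `P` fails.
[folklore] -/
theorem exists_prefix_before {V : Type*} {G : SimpleGraph V} (P : V → Prop) {u v : V} (p : G.Walk u v)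
    (hu : P u) (hv : ¬ P v) :
    ∃ (w w' : V) (q : G.Walk u w), G.Adj w w' ∧ ¬ P w' ∧ ∀ z ∈ q.support, P z := by
  induction p with
  | nil => exact absurd hu hv
  | @cons a x c h p' ih =>
    by_cases hx : P x
    · obtain ⟨w, w', q, hadj, hw', hq⟩ := ih hx hv
      refine ⟨w, w', Walk.cons h q, hadj, hw', fun z hz => ?_⟩
      rw [Walk.support_cons, List.mem_cons] at hz
      rcases hz with rfl | hz
      exacts [hu, hq z hz]
    · refine ⟨a, x, Walk.nil, h, hx, fun z hz => ?_⟩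
      rw [Walk.support_nil, List.mem_singleton] at hz
      rw [hz]
      exact hu

/-- **Restricting a mesh walk to a sub-domain**: a walk in the mesh graph of `Ω` on mesh vertices, all of
whose vertices have mesh point in `Ω'` and all of whose closed edges lie in `closure Ω'`, joins its ends
in the mesh graph of `Ω'` on mesh vertices. [folklore] -/
theorem reachable_restrict {Ω Ω' : Set ℂ} {δ : ℝ} :
    ∀ {u w : meshVertices Ω δ} (q : (meshVertexGraph Ω δ).Walk u w)
      (hV : ∀ z ∈ q.support, meshPoint δ (z : Site 2) ∈ Ω')
      (hE : ∀ e ∈ q.darts,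
        segment ℝ (meshPoint δ (e.fst : Site 2)) (meshPoint δ (e.snd : Site 2)) ⊆ closure Ω')
      (hu : meshPoint δ (u : Site 2) ∈ Ω') (hw : meshPoint δ (w : Site 2) ∈ Ω'),
      (meshVertexGraph Ω' δ).Reachable ⟨u, hu⟩ ⟨w, hw⟩
  | _, _, Walk.nil, _, _, _, _ => Reachable.refl _
  | _, _, Walk.cons (u := a) (v := x) h q, hV, hE, hu, hw => by
    have hxΩ' : meshPoint δ (x : Site 2) ∈ Ω' := hV x (by simp)
    have hmg : (meshGraph Ω δ).Adj (a : Site 2) (x : Site 2) := h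
    have hseg := hE ⟨(a, x), h⟩ (by simp)
    have hmg' : (meshGraph Ω' δ).Adj (a : Site 2) (x : Site 2) :=
      meshGraph_adj_iff.2 ⟨(meshGraph_adj_iff.1 hmg).1, hseg⟩
    have hadj : (meshVertexGraph Ω' δ).Adj ⟨a, hu⟩ ⟨x, hxΩ'⟩ := hmg'
    refine hadj.reachable.trans
      (reachable_restrict q (fun z hz => hV z (by simp [hz])) (fun e he => hE e ?_) hxΩ' hw)
    simp [he]

/-- **A mesh walk of a sub-domain starting in `Ω_δ` is a walk of `Ω_δ`**: for `Ω' ⊆ Ω`, a walk in the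
mesh graph of `Ω'` on mesh vertices starting at a vertex of `meshDomain Ω δ` is a walk of
`discreteDomainGraph Ω δ` (the largest-component graph is a union of mesh components), with the same
vertices, all of which have mesh point in `Ω'`. [folklore] -/
theorem exists_walk_discreteDomainGraph {Ω Ω' : Set ℂ} {δ : ℝ} (hsub : Ω' ⊆ Ω) :
    ∀ {u w : meshVertices Ω' δ} (_ : (meshVertexGraph Ω' δ).Walk u w), (u : Site 2) ∈ meshDomain Ω δ →
      ∃ p : (discreteDomainGraph Ω δ).Walk u w, ∀ z ∈ p.support, meshPoint δ z ∈ Ω'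
  | u, _, Walk.nil, _ => ⟨Walk.nil, fun z hz => by
      rw [Walk.support_nil, List.mem_singleton] at hz
      rw [hz]
      exact u.2⟩
  | a, _, Walk.cons (v := x) h q, ha => by
    have hmg' : (meshGraph Ω' δ).Adj (a : Site 2) (x : Site 2) := h
    obtain ⟨hzd, hseg⟩ := meshGraph_adj_iff.1 hmg'
    have hmg : (meshGraph Ω δ).Adj (a : Site 2) (x : Site 2) :=
      meshGraph_adj_iff.2 ⟨hzd, hseg.trans (closure_mono hsub)⟩
    have hav : (a : Site 2) ∈ meshVertices Ω δ := hsub a.2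
    have hxv : (x : Site 2) ∈ meshVertices Ω δ := hsub x.2
    have hadj : (meshVertexGraph Ω δ).Adj ⟨a, hav⟩ ⟨x, hxv⟩ := hmg
    have hx : (x : Site 2) ∈ meshDomain Ω δ :=
      mem_meshDomain_of_reachable_meshVertexGraph ha hav hxv hadj.reachable
    obtain ⟨p, hp⟩ := exists_walk_discreteDomainGraph hsub q hx
    refine ⟨Walk.cons (discreteDomainGraph_adj_iff.2 ⟨hmg, ha, hx⟩) p, fun z hz => ?_⟩
    rw [Walk.support_cons, List.mem_cons] at hz
    rcases hz with rfl | hz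
    exacts [a.2, hp z hz]

/-! ### The theorem -/

/-- **One ball-component at the marked prime end** (`ChartDiscOneComponent`): for the chordal chart
`φ` of `(D; a, b)` and `ε > 0` there is `R₀ > 0` such that for every `R < R₀` and all small `δ`, any two
vertices of `Ω_δ` of chart radius `< R` are joined by a walk of `Ω_δ` all of whose vertices have mesh
point in `B(a, ε)`. See the module docstring for the proof. [folklore] -/
theorem stub_chartDiscOneComponent : ChartDiscOneComponent := by
  intro D φ hφ ε hε
  obtain ⟨r, hr, hball⟩ := Metric.tendsto_nhdsWithin_nhds.1 hφ.1 ε hε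
  refine ⟨r / 2, half_pos hr, fun R hR hRr => ?_⟩
  -- the chart half-disc radius `ρ = 2R < r`
  set ρ : ℝ := 2 * R with hρdef
  have hρ : 0 < ρ := by positivity
  have hρr : ρ < r := by rw [hρdef]; linarith
  have hinball : ∀ z ∈ D.carrier, ‖φ.symm z‖ < ρ → z ∈ ball (D.pt 0) ε := by
    intro z hz hzr
    have h := hball (φ.symm_mapsTo hz) (by rw [dist_zero_right]; exact hzr.trans hρr)
    rwa [φ.apply_symm_apply hz] at h
  -- points of small chart radius are far from `b`
  obtain ⟨d, hd, hdball⟩ := Metric.mem_nhdsWithin_iff.1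
    (hφ.tendsto_symm_cocompact ((isCompact_closedBall (0 : ℂ) ρ).compl_mem_cocompact))
  have hfar : ∀ z ∈ D.carrier, ‖φ.symm z‖ ≤ ρ → d ≤ dist z (D.pt 1) := by
    intro z hz hzr
    by_contra h
    push Not at h
    have := hdball ⟨Metric.mem_ball.2 h, hz⟩
    simp only [mem_preimage, mem_compl_iff, mem_closedBall, dist_zero_right, not_le] at this
    linarith
  have hbD : D.pt 1 ∉ D.carrier := fun h =>
    (D.pt_mem_frontier 1).2 (by rwa [D.isOpen.interior_eq])
  -- the extension `g` of `φ⁻¹` and the compact `B` on which it is uniformly continuous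
  obtain ⟨g, hgc, hgeq, -, -, -⟩ := exists_chart_extension hφ
  set B : Set ℂ := closure D.carrier ∩ (ball (D.pt 1) (d / 2))ᶜ with hB
  have hBc : IsCompact B := D.isBounded.isCompact_closure.inter_right isOpen_ball.isClosed_compl
  have hBsub : B ⊆ closure D.carrier \ {D.pt 1} := by
    rintro z ⟨hz, hzb⟩
    refine ⟨hz, fun h => hzb ?_⟩
    rw [mem_singleton_iff] at h
    rw [h]
    exact Metric.mem_ball_self (half_pos hd)
  have hgB : ContinuousOn g B := hgc.mono hBsub
  have hmemB : ∀ z ∈ closure D.carrier, d / 2 ≤ dist z (D.pt 1) → z ∈ B := fun z hz hzd =>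
    ⟨hz, fun h => by rw [Metric.mem_ball] at h; linarith⟩
  have hR8 : 0 < R / 8 := by positivity
  obtain ⟨η, hη, hηg⟩ :=
    Metric.uniformContinuousOn_iff.1 (hBc.uniformContinuousOn_of_continuous hgB) (R / 8) hR8
  -- the chart half-disc `D'` and the two facts about its mesh graph
  obtain ⟨D', hD'⟩ := exists_chartHalfDisc D.toJordanDomain φ hρ
  have hD'sub : D'.carrier ⊆ D.carrier := by rw [hD']; exact fun z hz => hz.1
  obtain ⟨δA, hδA, hbig⟩ := D'.exists_mem_meshDomain_of_reachable hη
  obtain ⟨δB, hδB, hone⟩ :=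
    D'.exists_forall_mem_meshDomain_and_reachable isCompact_empty (empty_subset _)
  -- a far point of `D` and a compact ball around it swallowed by `Ω_δ`
  have hw₀ : (r : ℂ) * I ∈ upperHalfPlaneSet := by
    show 0 < ((r : ℂ) * I).im
    simpa using hr
  set zf : ℂ := φ ((r : ℂ) * I) with hzf
  have hzfD : zf ∈ D.carrier := φ.mapsTo hw₀
  have hzfs : φ.symm zf = (r : ℂ) * I := φ.symm_apply_apply hw₀
  have hzfn : ‖φ.symm zf‖ = r := by
    rw [hzfs, norm_mul, norm_real, norm_I, mul_one, Real.norm_eq_abs, abs_of_pos hr]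
  obtain ⟨s₁, hs₁, hs₁D⟩ := Metric.isOpen_iff.1 D.isOpen zf hzfD
  have hcont : ContinuousAt φ.symm zf := (φ.symm.continuousOn zf hzfD).continuousAt (D.isOpen.mem_nhds hzfD)
  obtain ⟨s₂, hs₂, hs₂c⟩ := Metric.continuousAt_iff.1 hcont (r - ρ) (by linarith)
  set s : ℝ := min s₁ s₂ / 2 with hs
  have hs0 : 0 < s := by positivity
  have hss₁ : s < s₁ := by
    have := min_le_left s₁ s₂
    rw [hs]; linarith
  have hss₂ : s < s₂ := by
    have := min_le_right s₁ s₂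
    rw [hs]; linarith
  have hKD : closedBall zf s ⊆ D.carrier := fun z hz =>
    hs₁D (mem_ball.2 ((mem_closedBall.1 hz).trans_lt hss₁))
  have hKρ : ∀ z ∈ closedBall zf s, ρ < ‖φ.symm z‖ := by
    intro z hz
    have h1 : dist (φ.symm z) (φ.symm zf) < r - ρ := hs₂c ((mem_closedBall.1 hz).trans_lt hss₂)
    rw [dist_eq_norm] at h1
    have h2 := norm_sub_norm_le (φ.symm zf) (φ.symm z)
    rw [← norm_neg, neg_sub] at h1
    linarith
  obtain ⟨δC, hδC, hbulk⟩ :=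
    D.toJordanDomain.exists_forall_mem_meshDomain_and_reachable (isCompact_closedBall zf s) hKD
  -- the threshold
  have hδ₀ : 0 < min (min η (d / 4)) (min (min δA δB) (min δC s)) := by positivity
  filter_upwards [Ioo_mem_nhdsGT hδ₀] with δ hδ
  obtain ⟨hδ0, hδlt⟩ := hδ
  have hδη : δ < η := hδlt.trans_le ((min_le_left _ _).trans (min_le_left _ _))
  have hδd : δ < d / 4 := hδlt.trans_le ((min_le_left _ _).trans (min_le_right _ _))
  have hδA' : δ < δA := hδlt.trans_le ((min_le_right _ _).trans ((min_le_left _ _).trans (min_le_left _ _)))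
  have hδB' : δ < δB := hδlt.trans_le ((min_le_right _ _).trans ((min_le_left _ _).trans (min_le_right _ _)))
  have hδC' : δ < δC := hδlt.trans_le ((min_le_right _ _).trans ((min_le_right _ _).trans (min_le_left _ _)))
  have hδs : δ < s := hδlt.trans_le ((min_le_right _ _).trans ((min_le_right _ _).trans (min_le_right _ _)))
  -- chart oscillation over `δ` near a point of chart radius `< ρ`
  have hnearB : ∀ u ∈ D.carrier, ‖φ.symm u‖ < ρ → ∀ z ∈ closure D.carrier, dist z u ≤ δ →
      z ∈ B ∧ u ∈ B ∧ dist (g z) (g u) < R / 8 := by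
    intro u hu hur z hz hzu
    have hub : d ≤ dist u (D.pt 1) := hfar u hu hur.le
    have huB : u ∈ B := hmemB u (subset_closure hu) (by linarith)
    have hzB : z ∈ B :=
      hmemB z hz (by linarith [dist_triangle u z (D.pt 1), _root_.dist_comm z u])
    exact ⟨hzB, huB, hηg z hzB u huB (by linarith)⟩
  -- KEY: a vertex of `Ω_δ` of chart radius `< R` lies in `meshDomain D'`
  have key : ∀ x ∈ meshDomain D.carrier δ, ‖φ.symm (meshPoint δ x)‖ < R →
      x ∈ meshDomain D'.carrier δ := by
    intro x hx hxR
    set xf : Site 2 := nearestSite δ zf with hxf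
    have hxfK : meshPoint δ xf ∈ closedBall zf s :=
      mem_closedBall.2 ((dist_meshPoint_nearestSite_le hδ0 zf).trans hδs.le)
    have hxfD : xf ∈ meshDomain D.carrier δ := (hbulk δ hδ0 hδC').1 xf hxfK
    obtain ⟨hxv, hxfv, hreach⟩ := (hbulk δ hδ0 hδC').2 x hx xf hxfD
    obtain ⟨W⟩ := hreach
    set P : meshVertices D.carrier δ → Prop := fun v => ‖φ.symm (meshPoint δ (v : Site 2))‖ < ρ - R / 8
      with hP
    have hPx : P ⟨x, hxv⟩ := by simp only [hP]; rw [hρdef]; linarith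
    have hPxf : ¬ P ⟨xf, hxfv⟩ := by
      simp only [hP, not_lt]
      linarith [hKρ _ hxfK]
    obtain ⟨w, w', q, hadj, hw', hq⟩ := exists_prefix_before P W hPx hPxf
    have hwP : P w := hq w q.end_mem_support
    simp only [hP, not_lt] at hwP hw'
    -- chart radius of `w` is at least `ρ - R/4`
    have hmg : (meshGraph D.carrier δ).Adj (w : Site 2) (w' : Site 2) := hadj
    have hzd := (meshGraph_adj_iff.1 hmg).1
    have hdww' : dist (meshPoint δ (w' : Site 2)) (meshPoint δ (w : Site 2)) ≤ δ := by
      rw [_root_.dist_comm]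
      have := (Literature.Probability.Percolation.dist_meshPoint_of_adj (δ := δ) hzd).le
      rwa [abs_of_pos hδ0] at this
    have hwD : meshPoint δ (w : Site 2) ∈ D.carrier := w.2
    have hw'D : meshPoint δ (w' : Site 2) ∈ D.carrier := w'.2
    obtain ⟨-, hwB, hgww'⟩ := hnearB _ hwD (by linarith) _ (subset_closure hw'D) hdww'
    rw [hgeq hw'D, hgeq hwD, dist_eq_norm] at hgww'
    have hwlow : ρ - R / 4 ≤ ‖φ.symm (meshPoint δ (w : Site 2))‖ := by
      have := norm_sub_norm_le (φ.symm (meshPoint δ (w' : Site 2))) (φ.symm (meshPoint δ (w : Site 2)))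
      linarith
    -- the piece `q` is a walk of the mesh graph of `D'`
    have hmemD' : ∀ z : meshVertices D.carrier δ, P z → meshPoint δ (z : Site 2) ∈ D'.carrier := by
      intro z hz
      rw [hD']
      simp only [hP] at hz
      exact ⟨z.2, by linarith⟩
    have hV : ∀ z ∈ q.support, meshPoint δ (z : Site 2) ∈ D'.carrier := fun z hz => hmemD' z (hq z hz)
    have hE : ∀ e ∈ q.darts,
        segment ℝ (meshPoint δ (e.fst : Site 2)) (meshPoint δ (e.snd : Site 2)) ⊆ closure D'.carrier := by
      intro e he y hy
      have hu := hq _ (q.dart_fst_mem_support_of_mem_darts he)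
      simp only [hP] at hu
      have hmge : (meshGraph D.carrier δ).Adj (e.fst : Site 2) (e.snd : Site 2) := e.adj
      obtain ⟨hzde, hsege⟩ := meshGraph_adj_iff.1 hmge
      have huD : meshPoint δ (e.fst : Site 2) ∈ D.carrier := e.fst.2
      have hdist : dist (meshPoint δ (e.snd : Site 2)) (meshPoint δ (e.fst : Site 2)) ≤ δ := by
        rw [_root_.dist_comm]
        have := (Literature.Probability.Percolation.dist_meshPoint_of_adj (δ := δ) hzde).le
        rwa [abs_of_pos hδ0] at this
      have hyu : dist y (meshPoint δ (e.fst : Site 2)) ≤ δ :=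
        (convex_closedBall _ _).segment_subset (mem_closedBall_self hδ0.le) (mem_closedBall.2 hdist) hy
      obtain ⟨hyB, -, hgy⟩ := hnearB _ huD (by linarith) y (hsege hy) hyu
      rw [hgeq huD, dist_eq_norm] at hgy
      have hgyρ : ‖g y‖ < ρ := by
        have := norm_sub_norm_le (g y) (φ.symm (meshPoint δ (e.fst : Site 2)))
        linarith
      rw [hD']
      exact mem_closure_chartHalfDisc hbD hgc hgeq (hBsub hyB).1 (hBsub hyB).2 hgyρ
    have hxD' : meshPoint δ x ∈ D'.carrier := hmemD' ⟨x, hxv⟩ hPx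
    have hwD' : meshPoint δ (w : Site 2) ∈ D'.carrier := hmemD' w (by simp only [hP]; linarith)
    have hreach' : (meshVertexGraph D'.carrier δ).Reachable ⟨x, hxD'⟩ ⟨(w : Site 2), hwD'⟩ :=
      reachable_restrict q hV hE hxD' hwD'
    refine hbig δ hδ0 hδA' ⟨x, hxD'⟩ ⟨(w : Site 2), hwD'⟩ hreach' ?_
    -- `dist (δx) (δw) ≥ η`
    by_contra hlt
    push Not at hlt
    have hxD : meshPoint δ x ∈ D.carrier := hxv
    obtain ⟨-, hxB, -⟩ :=
      hnearB _ hxD (by linarith) _ (subset_closure hxD) (by rw [_root_.dist_self]; exact hδ0.le)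
    have h1 := hηg _ hxB _ hwB hlt
    rw [hgeq hxD, hgeq hwD, dist_eq_norm] at h1
    have h2 := norm_sub_norm_le (φ.symm (meshPoint δ (w : Site 2))) (φ.symm (meshPoint δ x))
    rw [← norm_neg, neg_sub] at h1
    linarith
  -- conclusion
  intro x hx y hy hxR hyR
  have hxD' := key x hx hxR
  have hyD' := key y hy hyR
  obtain ⟨hxv', hyv', hreach⟩ := (hone δ hδ0 hδB').2 x hxD' y hyD'
  obtain ⟨Q⟩ := hreach
  obtain ⟨p, hp⟩ := exists_walk_discreteDomainGraph hD'sub Q hx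
  refine ⟨p, fun z hz => ?_⟩
  have hz' := hp z hz
  rw [hD'] at hz'
  exact hinball _ hz'.1 hz'.2

end Summit.CriticalPhenomena.SAWScalingLimit.Theorems.IsingBoundaryRatio

end
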